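import Literature.AlgebraicGeometry.Motives.HodgeLieDiagonal
import HarnessLib

/-!
# Multiplicities do not change the Hodge Lie algebra: `dim 𝔥(⊕_i H_i^{⊕ m_i}) = dim 𝔥(⊕_i H_i)`
# (Moonen–Zarhin 1999 §1 / Moonen 1999 (1.8): `Hg(∏ X_i^{n_i}) = Hg(∏ X_i)`)

Family `hodge`, layer `Literature/AlgebraicGeometry/Motives`; THEOREMS ONLY (no definition, no named fact; net debt 0).
Written for the cell `pub-hodgecm2` (COR-CM), seat `b27` gen 43 (count-neutral Mumford–Tate-rank ladder).  Generalises
`Motives/HodgeLieDiagonal` (gen 42: the constant family, `𝔥(H^{⊕ι}) = Δ 𝔥(H)`) from one Hodge structure to a finite family: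
for pure `ℚ`-Hodge structures `H_i` (`i ∈ ι` finite) and nonempty finite multiplicity sets `m_i`, the Hodge Lie algebra of
`⊕_{(i,k) : Σ i, m_i} H_i` has the dimension of that of the multiplicity-free sum `⊕_i H_i`.  For complex abelian varieties
this is «the Hodge group of `X` depends only on the set of simple factors of `X`, not on their multiplicities»
(`Hg(∏ B_i^{n_i}) ≅ Hg(∏ B_i)`; Moonen–Zarhin 1999 §1, Moonen 1999 (1.8)), i.e. `dim MT(H¹(∏ B_i^{n_i})) = dim MT(H¹(∏ B_i))`
for the Mumford–Tate-rank ladder (the tree proved it shape by shape: `B^{m+1}`, `B₁^{a+1} × B₂^{b+1}`, …).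

MECHANISM.  Every `X ∈ 𝔥(⊕_j G_j)` is block diagonal (`proj_comp_single_eq_zero_of_mem_hodgeLie_pi`: it commutes with the
Hodge idempotents) and its diagonal blocks on two coordinates carrying the SAME Hodge structure coincide (it commutes with
the Hodge endomorphism swapping them, `commute_single_comp_proj_of_mem_hodgeLie_pi`); so (§1–§2) the compression
`X ↦ π X ι` to one coordinate per `i` is an injection `𝔥(⊕_{(i,k)} H_i) ↪ 𝔥(⊕_i H_i)`.  Conversely (§3) the fibrewise diagonal
`Y ↦ Δ(Y) = Σ_{(i,k)} in_{(i,k)} Y_{ii} pr_{(i,k)}` maps `𝔥(⊕_i H_i)` into `𝔥(⊕_{(i,k)} H_i)` by the block criterion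
`mem_hodgeLie_of_blocks` of `Motives/HodgeLieDiagonal` (with `in_{(i,k)} = single_{(i,k)} ∘ proj_i`,
`pr_{(i,k)} = single_i ∘ proj_{(i,k)}`, `Σ in ∘ pr = id`), injectively.  §4: equality of dimensions.

* §1 `proj_comp_single_eq_of_mem_hodgeLie_pi_sigma` — equal diagonal blocks along a fibre.
* §2 `finrank_hodgeLie_pi_sigma_le` — `dim 𝔥(⊕_{(i,k)} H_i) ≤ dim 𝔥(⊕_i H_i)` (fibres nonempty).
* §3 `fibreDiagonal_mem_hodgeLie_pi_sigma`, `finrank_hodgeLie_pi_le_sigma` — `Δ(Y) ∈ 𝔥(⊕_{(i,k)} H_i)`, `≥`.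
* §4 **`finrank_hodgeLie_pi_sigma_eq`** — `dim 𝔥(⊕_{(i,k)} H_i) = dim 𝔥(⊕_i H_i)`.

## References
* [MoonenZarhin1999LowDim] B. Moonen, Yu. Zarhin, *Hodge classes on abelian varieties of low dimension*, Math. Ann. 315
  (1999), §1 («we can identify `Hg(Xⁿ)` with `Hg(X)` acting diagonally») and §3 (3.1) [corpus: paper:arxiv-math_9901113 pp. 2, 6].
  [cite: MoonenZarhin1999LowDim, §1 and §3]
* [Moonen1999MTNotes] B. Moonen, *Notes on Mumford–Tate groups* (1999), (1.8). [cite: Moonen1999MTNotes, (1.8)]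
* [Deligne1982HodgeCycles] P. Deligne, LNM 900 (1982), I §3.1 and Prop. 3.4. [cite: Deligne1982HodgeCycles, I §3.1 and Prop. 3.4]
* [DeligneHodgeII1971] P. Deligne, *Théorie de Hodge II*, 2.1 (direct sums). [cite: DeligneHodgeII1971, 2.1]
-/

noncomputable section

namespace Literature.AlgebraicGeometry.Motives

namespace HodgeStructure

universe u

variable {ι : Type} [Fintype ι] [DecidableEq ι] {m : ι → Type} [∀ i, Fintype (m i)] [∀ i, DecidableEq (m i)]
  {W : ι → Type u} [∀ i, AddCommGroup (W i)] [∀ i, Module ℚ (W i)] [∀ i, Module.Finite ℚ (W i)]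
  [HodgeTensorFacts.{u, u}] {n : ℤ} (H : ∀ i, HodgeStructure (W i) n)

/-! ### §1 Diagonal blocks along a fibre coincide -/

/-- **For `X ∈ 𝔥(⊕_{(i,k)} H_i)` the diagonal blocks at `(i, k)` and `(i, k')` coincide**: `X` commutes with the Hodge
endomorphism `single_{(i,k)} ∘ proj_{(i,k')}` of the sum (both coordinates carry `H_i`). [cite: MoonenZarhin1999LowDim, §1 and §3]
[cite: Deligne1982HodgeCycles, I §3.1 and Prop. 3.4] -/
theorem proj_comp_single_eq_of_mem_hodgeLie_pi_sigma {X : Module.End ℚ (∀ p : Σ i, m i, W p.1)}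
    (hX : X ∈ (pi fun p : Σ i, m i => H p.1).hodgeLie) (i : ι) (k k' : m i) :
    LinearMap.proj (⟨i, k⟩ : Σ i, m i) ∘ₗ X ∘ₗ LinearMap.single ℚ (fun p : Σ i, m i => W p.1) ⟨i, k⟩ =
      LinearMap.proj (⟨i, k'⟩ : Σ i, m i) ∘ₗ X ∘ₗ LinearMap.single ℚ (fun p : Σ i, m i => W p.1) ⟨i, k'⟩ := by
  have hc := commute_single_comp_proj_of_mem_hodgeLie_pi (fun p : Σ i, m i => H p.1) (i := ⟨i, k⟩) (j := ⟨i, k'⟩)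
    (Hom.id (H i)) hX
  have hid : (Hom.id (H i)).toLinearMap = LinearMap.id := rfl
  rw [hid, LinearMap.id_comp] at hc
  refine LinearMap.ext fun w => ?_
  have h := LinearMap.congr_fun hc (Pi.single (⟨i, k'⟩ : Σ i, m i) w)
  simp only [Module.End.mul_apply, LinearMap.comp_apply, LinearMap.proj_apply, Pi.single_eq_same,
    LinearMap.coe_single] at h
  have h' := congrArg (fun f : (∀ p : Σ i, m i, W p.1) => f ⟨i, k⟩) h
  simp only [Pi.single_eq_same] at h'
  rw [LinearMap.comp_apply, LinearMap.comp_apply, LinearMap.coe_single, LinearMap.proj_apply, h',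
    LinearMap.comp_apply, LinearMap.comp_apply, LinearMap.coe_single, LinearMap.proj_apply]

/-! ### §2 `dim 𝔥(⊕_{(i,k)} H_i) ≤ dim 𝔥(⊕_i H_i)` -/

/-- **`dim_ℚ 𝔥(⊕_{(i,k)} H_i) ≤ dim_ℚ 𝔥(⊕_i H_i)`** (all fibres `m_i` nonempty): the compression `X ↦ π X ι` along the retract
`ι(v)_{(i,k)} = v_i`, `π(w)_i = w_{(i, k₀ i)}` lands in `𝔥(⊕_i H_i)` (`comp_mem_hodgeLie_of_retract`) and is injective — an
`X` with all compressed blocks zero has all diagonal blocks zero (§1) and is block diagonal. [cite: MoonenZarhin1999LowDim, §1 and §3]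
[cite: Moonen1999MTNotes, (1.8)] -/
theorem finrank_hodgeLie_pi_sigma_le [∀ i, Nonempty (m i)] :
    Module.finrank ℚ (pi fun p : Σ i, m i => H p.1).hodgeLie ≤ Module.finrank ℚ (pi H).hodgeLie := by
  classical
  let k₀ : ∀ i, m i := fun i => Classical.arbitrary (m i)
  -- the retract `ι : ⊕_i H_i → ⊕_{(i,k)} H_i`, `π : ⊕_{(i,k)} H_i → ⊕_i H_i`
  let ιH : Hom (pi H) (pi fun p : Σ i, m i => H p.1) := Hom.piLift fun p => Hom.piProj H p.1
  let πH : Hom (pi fun p : Σ i, m i => H p.1) (pi H) := Hom.piLift fun i => Hom.piProj (fun p : Σ i, m i => H p.1) ⟨i, k₀ i⟩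
  have hπι : ∀ v, πH.toLinearMap (ιH.toLinearMap v) = v := fun v => by
    funext i
    rfl
  let Φ : (pi fun p : Σ i, m i => H p.1).hodgeLie →ₗ[ℚ] (pi H).hodgeLie :=
    { toFun := fun X => ⟨πH.toLinearMap ∘ₗ (X : Module.End ℚ _) ∘ₗ ιH.toLinearMap,
        comp_mem_hodgeLie_of_retract ιH πH hπι X.2⟩
      map_add' := fun X Y => Subtype.ext (by
        simp only [Submodule.coe_add, LinearMap.comp_add, LinearMap.add_comp])
      map_smul' := fun c X => Subtype.ext (by
        simp only [Submodule.coe_smul, LinearMap.comp_smul, LinearMap.smul_comp, RingHom.id_apply]) }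
  -- the compressed block at `i` is the diagonal block of `X` at `(i, k₀ i)`
  have hblock : ∀ (X : Module.End ℚ (∀ p : Σ i, m i, W p.1)),
      X ∈ (pi fun p : Σ i, m i => H p.1).hodgeLie → ∀ i,
      LinearMap.proj i ∘ₗ (πH.toLinearMap ∘ₗ X ∘ₗ ιH.toLinearMap) ∘ₗ LinearMap.single ℚ W i =
        LinearMap.proj (⟨i, k₀ i⟩ : Σ i, m i) ∘ₗ X ∘ₗ LinearMap.single ℚ (fun p : Σ i, m i => W p.1) ⟨i, k₀ i⟩ := by
    intro X hX i
    refine LinearMap.ext fun u => ?_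
    -- `ι (single_i u) = Σ_p single_p ((single_i u) p.1)`
    have hι : ιH.toLinearMap (Pi.single i u) = ∑ p : Σ i, m i, Pi.single p ((Pi.single i u : ∀ j, W j) p.1) :=
      (Finset.univ_sum_single _).symm
    change (X (ιH.toLinearMap (Pi.single i u))) ⟨i, k₀ i⟩ = (X (Pi.single (⟨i, k₀ i⟩ : Σ i, m i) u)) ⟨i, k₀ i⟩
    rw [hι, map_sum, Finset.sum_apply, Finset.sum_eq_single (⟨i, k₀ i⟩ : Σ i, m i)]
    · simp only [Pi.single_eq_same]
    · intro p _ hp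
      have h0 := proj_comp_single_eq_zero_of_mem_hodgeLie_pi (fun p : Σ i, m i => H p.1) (Ne.symm hp) hX
      have := LinearMap.congr_fun h0 ((Pi.single i u : ∀ j, W j) p.1)
      simpa only [LinearMap.comp_apply, LinearMap.coe_single, LinearMap.proj_apply, LinearMap.zero_apply] using this
    · intro h; exact absurd (Finset.mem_univ _) h
  have hΦ : Function.Injective Φ := by
    rw [injective_iff_map_eq_zero]
    intro X hX0
    have h0 : πH.toLinearMap ∘ₗ (X : Module.End ℚ _) ∘ₗ ιH.toLinearMap = 0 :=
      congrArg (fun Y : (pi H).hodgeLie => (Y : Module.End ℚ (∀ i, W i))) hX0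
    refine Subtype.ext (eq_zero_of_forall_proj_comp_single_eq_zero (fun p : Σ i, m i => H p.1) X.2 fun p => ?_)
    obtain ⟨i, k⟩ := p
    rw [proj_comp_single_eq_of_mem_hodgeLie_pi_sigma H X.2 i k (k₀ i), ← hblock _ X.2 i, h0]
    simp only [LinearMap.zero_comp, LinearMap.comp_zero]
  exact LinearMap.finrank_le_finrank_of_injective hΦ

/-! ### §3 The fibrewise diagonal: `dim 𝔥(⊕_i H_i) ≤ dim 𝔥(⊕_{(i,k)} H_i)` -/

omit [Fintype ι] [∀ i, Module.Finite ℚ (W i)] [HodgeTensorFacts.{u, u}] [∀ i, Fintype (m i)] [∀ i, DecidableEq (m i)] in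
/-- Off-diagonal components of `Y (single_i u)` vanish for a block-diagonal `Y`: if `proj_{i'} Y single_i = 0` for `i' ≠ i`
then `Y (single_i u) = single_i ((Y (single_i u)) i)`. [folklore] -/
private theorem apply_single_eq_single_of_blocks {Y : Module.End ℚ (∀ i, W i)}
    (hoff : ∀ i i', i' ≠ i → LinearMap.proj i' ∘ₗ Y ∘ₗ LinearMap.single ℚ W i = 0) (i : ι) (u : W i) :
    Y (Pi.single i u) = Pi.single i ((Y (Pi.single i u)) i) := by
  funext i'
  by_cases h : i' = i
  · subst h; rw [Pi.single_eq_same]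
  · rw [Pi.single_eq_of_ne h]
    have := LinearMap.congr_fun (hoff i i' h) u
    simpa only [LinearMap.comp_apply, LinearMap.coe_single, LinearMap.proj_apply, LinearMap.zero_apply] using this

omit [∀ i, Module.Finite ℚ (W i)] [HodgeTensorFacts.{u, u}] [∀ i, Fintype (m i)] [∀ i, DecidableEq (m i)] in
/-- The `i`-th component of `Y v` is that of `Y (single_i (v i))` for a block-diagonal `Y`. [folklore] -/
private theorem apply_proj_eq_of_blocks {Y : Module.End ℚ (∀ i, W i)}
    (hoff : ∀ i i', i' ≠ i → LinearMap.proj i' ∘ₗ Y ∘ₗ LinearMap.single ℚ W i = 0) (v : ∀ i, W i) (i : ι) :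
    (Y v) i = (Y (Pi.single i (v i))) i := by
  conv_lhs => rw [← Finset.univ_sum_single v]
  rw [map_sum, Finset.sum_apply, Finset.sum_eq_single i]
  · intro i' _ hi'
    have := LinearMap.congr_fun (hoff i' i (Ne.symm hi')) (v i')
    simpa only [LinearMap.comp_apply, LinearMap.coe_single, LinearMap.proj_apply, LinearMap.zero_apply] using this
  · intro h; exact absurd (Finset.mem_univ _) h

/-- **The fibrewise diagonal `Δ(Y) = Σ_{(i,k)} single_{(i,k)} ∘ (proj_i Y single_i) ∘ proj_{(i,k)}` of `Y ∈ 𝔥(⊕_i H_i)` lies in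
`𝔥(⊕_{(i,k)} H_i)`** — the block criterion `mem_hodgeLie_of_blocks` for `in_{(i,k)} = single_{(i,k)} ∘ proj_i`,
`pr_{(i,k)} = single_i ∘ proj_{(i,k)}` (`Σ in ∘ pr = id`; the intertwining relations hold because `Y` is block diagonal).
[cite: MoonenZarhin1999LowDim, §1 and §3] [cite: Moonen1999MTNotes, (1.8)] [cite: DeligneHodgeII1971, 2.1] -/
theorem fibreDiagonal_mem_hodgeLie_pi_sigma {Y : Module.End ℚ (∀ i, W i)} (hY : Y ∈ (pi H).hodgeLie) :
    (∑ p : Σ i, m i, LinearMap.single ℚ (fun p : Σ i, m i => W p.1) p ∘ₗ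
        (LinearMap.proj p.1 ∘ₗ Y ∘ₗ LinearMap.single ℚ W p.1) ∘ₗ LinearMap.proj p) ∈
      (pi fun p : Σ i, m i => H p.1).hodgeLie := by
  classical
  have hoff : ∀ i i', i' ≠ i → LinearMap.proj i' ∘ₗ Y ∘ₗ LinearMap.single ℚ W i = 0 :=
    fun i i' h => proj_comp_single_eq_zero_of_mem_hodgeLie_pi H h hY
  let inj : (Σ i, m i) → Hom (pi H) (pi fun p : Σ i, m i => H p.1) :=
    fun p => (Hom.piSingle (fun p : Σ i, m i => H p.1) p).comp (Hom.piProj H p.1)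
  let pr : (Σ i, m i) → Hom (pi fun p : Σ i, m i => H p.1) (pi H) :=
    fun p => (Hom.piSingle H p.1).comp (Hom.piProj (fun p : Σ i, m i => H p.1) p)
  have hinj_apply : ∀ p (v : ∀ i, W i), (inj p).toLinearMap v = Pi.single p (v p.1) := fun p v => rfl
  have hpr_apply : ∀ p (w : ∀ p : Σ i, m i, W p.1), (pr p).toLinearMap w = Pi.single p.1 (w p) := fun p w => rfl
  have hsum : ∑ p, (inj p).toLinearMap ∘ₗ (pr p).toLinearMap = LinearMap.id := by
    refine LinearMap.ext fun w => ?_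
    rw [LinearMap.sum_apply, LinearMap.id_apply]
    conv_rhs => rw [← Finset.univ_sum_single w]
    refine Finset.sum_congr rfl fun p _ => ?_
    rw [LinearMap.comp_apply, hpr_apply, hinj_apply, Pi.single_eq_same]
  have hX : (∑ p : Σ i, m i, LinearMap.single ℚ (fun p : Σ i, m i => W p.1) p ∘ₗ
      (LinearMap.proj p.1 ∘ₗ Y ∘ₗ LinearMap.single ℚ W p.1) ∘ₗ LinearMap.proj p) =
      ∑ p, (inj p).toLinearMap ∘ₗ Y ∘ₗ (pr p).toLinearMap := by
    refine Finset.sum_congr rfl fun p _ => LinearMap.ext fun w => ?_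
    simp only [LinearMap.comp_apply, hinj_apply, hpr_apply, LinearMap.coe_single, LinearMap.proj_apply]
  rw [hX]
  refine mem_hodgeLie_of_blocks inj pr hsum hY (fun p => ?_) (fun p => ?_)
  · -- `in_p ∘ Y = X ∘ in_p`
    refine LinearMap.ext fun v => ?_
    rw [LinearMap.comp_apply, LinearMap.comp_apply, LinearMap.sum_apply,
      Finset.sum_eq_single_of_mem p (Finset.mem_univ p)]
    · simp only [LinearMap.comp_apply, hinj_apply, hpr_apply, Pi.single_eq_same]
      rw [← apply_proj_eq_of_blocks hoff v p.1]
    · intro p' _ hp'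
      simp only [LinearMap.comp_apply, hinj_apply, hpr_apply, Pi.single_eq_of_ne hp', Pi.single_zero, map_zero,
        Pi.zero_apply]
  · -- `pr_p ∘ X = Y ∘ pr_p`
    refine LinearMap.ext fun w => ?_
    rw [LinearMap.comp_apply, LinearMap.comp_apply, LinearMap.sum_apply, map_sum,
      Finset.sum_eq_single_of_mem p (Finset.mem_univ p)]
    · simp only [LinearMap.comp_apply, hinj_apply, hpr_apply, Pi.single_eq_same]
      exact (apply_single_eq_single_of_blocks hoff p.1 (w p)).symm
    · intro p' _ hp'
      simp only [LinearMap.comp_apply, hinj_apply, hpr_apply, Pi.single_eq_of_ne hp'.symm, Pi.single_zero]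

/-- **`dim_ℚ 𝔥(⊕_i H_i) ≤ dim_ℚ 𝔥(⊕_{(i,k)} H_i)`** (all fibres nonempty): the fibrewise diagonal is an injective linear map
`𝔥(⊕_i H_i) → 𝔥(⊕_{(i,k)} H_i)` (its block at `(i, k₀ i)` recovers the block `Y_{ii}`, and `Y` is block diagonal).
[cite: MoonenZarhin1999LowDim, §1 and §3] [cite: Moonen1999MTNotes, (1.8)] -/
theorem finrank_hodgeLie_pi_le_sigma [∀ i, Nonempty (m i)] :
    Module.finrank ℚ (pi H).hodgeLie ≤ Module.finrank ℚ (pi fun p : Σ i, m i => H p.1).hodgeLie := by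
  classical
  let k₀ : ∀ i, m i := fun i => Classical.arbitrary (m i)
  let Δ₀ : Module.End ℚ (∀ i, W i) →ₗ[ℚ] Module.End ℚ (∀ p : Σ i, m i, W p.1) :=
    { toFun := fun Y => ∑ p : Σ i, m i, LinearMap.single ℚ (fun p : Σ i, m i => W p.1) p ∘ₗ
          (LinearMap.proj p.1 ∘ₗ Y ∘ₗ LinearMap.single ℚ W p.1) ∘ₗ LinearMap.proj p
      map_add' := fun Y Z => by
        simp only [LinearMap.comp_add, LinearMap.add_comp, Finset.sum_add_distrib]
      map_smul' := fun c Y => by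
        simp only [LinearMap.comp_smul, LinearMap.smul_comp, RingHom.id_apply, Finset.smul_sum] }
  have hΔ₀ : ∀ Y, Δ₀ Y = ∑ p : Σ i, m i, LinearMap.single ℚ (fun p : Σ i, m i => W p.1) p ∘ₗ
      (LinearMap.proj p.1 ∘ₗ Y ∘ₗ LinearMap.single ℚ W p.1) ∘ₗ LinearMap.proj p := fun _ => rfl
  -- the diagonal block of `Δ(Y)` at `p` is the block of `Y` at `p.1`
  have hblock : ∀ (Y : Module.End ℚ (∀ i, W i)) (p : Σ i, m i),
      LinearMap.proj p ∘ₗ Δ₀ Y ∘ₗ LinearMap.single ℚ (fun p : Σ i, m i => W p.1) p =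
        LinearMap.proj p.1 ∘ₗ Y ∘ₗ LinearMap.single ℚ W p.1 := by
    intro Y p
    refine LinearMap.ext fun u => ?_
    rw [LinearMap.comp_apply, LinearMap.comp_apply, hΔ₀, LinearMap.sum_apply, map_sum, Finset.sum_eq_single p]
    · simp only [LinearMap.comp_apply, LinearMap.coe_single, LinearMap.proj_apply, Pi.single_eq_same]
    · intro p' _ hp'
      simp only [LinearMap.comp_apply, LinearMap.coe_single, LinearMap.proj_apply,
        Pi.single_eq_of_ne (Ne.symm hp').symm, map_zero]
    · intro h; exact absurd (Finset.mem_univ _) h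
  let Φ : (pi H).hodgeLie →ₗ[ℚ] (pi fun p : Σ i, m i => H p.1).hodgeLie :=
    { toFun := fun Y => ⟨Δ₀ Y, by rw [hΔ₀]; exact fibreDiagonal_mem_hodgeLie_pi_sigma H Y.2⟩
      map_add' := fun Y Z => Subtype.ext (by
        change Δ₀ ((Y : Module.End ℚ (∀ i, W i)) + Z) = Δ₀ Y + Δ₀ Z
        exact map_add Δ₀ _ _)
      map_smul' := fun c Y => Subtype.ext (by
        change Δ₀ (c • (Y : Module.End ℚ (∀ i, W i))) = c • Δ₀ Y
        exact map_smul Δ₀ _ _) }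
  have hΦ : Function.Injective Φ := by
    rw [injective_iff_map_eq_zero]
    intro Y hY0
    have h0 : Δ₀ (Y : Module.End ℚ (∀ i, W i)) = 0 :=
      congrArg (fun X : (pi fun p : Σ i, m i => H p.1).hodgeLie => (X : Module.End ℚ (∀ p : Σ i, m i, W p.1))) hY0
    refine Subtype.ext (eq_zero_of_forall_proj_comp_single_eq_zero H Y.2 fun i => ?_)
    rw [← hblock (Y : Module.End ℚ (∀ i, W i)) ⟨i, k₀ i⟩, h0]
    simp only [LinearMap.zero_comp, LinearMap.comp_zero]
  exact LinearMap.finrank_le_finrank_of_injective hΦ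

/-! ### §4 Equality -/

/-- **Multiplicities do not change the dimension of the Hodge Lie algebra:
`dim_ℚ 𝔥(⊕_{(i,k) : Σ i, m_i} H_i) = dim_ℚ 𝔥(⊕_i H_i)`** for nonempty finite multiplicity sets `m_i` — «`Hg(∏ X_i^{n_i})` is
`Hg(∏ X_i)` acting diagonally on each isotypic block».  For complex abelian varieties: `dim MT(H¹(∏ B_i^{n_i})) = dim MT(H¹(∏ B_i))`.
[cite: MoonenZarhin1999LowDim, §1 and §3] [cite: Moonen1999MTNotes, (1.8)] -/
theorem finrank_hodgeLie_pi_sigma_eq [∀ i, Nonempty (m i)] :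
    Module.finrank ℚ (pi fun p : Σ i, m i => H p.1).hodgeLie = Module.finrank ℚ (pi H).hodgeLie :=
  le_antisymm (finrank_hodgeLie_pi_sigma_le H) (finrank_hodgeLie_pi_le_sigma H)

end HodgeStructure

end Literature.AlgebraicGeometry.Motives

end
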